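import Summits.QuantumFields.YangMills.Theorems.BalabanUVNodesN15KingModelSchwingerFunctionsThermodynamicLimit
import Summits.QuantumFields.YangMills.Theorems.BalabanUVNodesN15KingModelTwoPointCommutingSquare
import Summits.QuantumFields.YangMills.Theorems.BalabanUVNodesN15KingModelTwoPointFiniteKInfiniteVolume

/-!
# BalabanUVNodes ∕ N15 — THE KING-MODEL RUNG (PART Ϸ-f): THE COMMUTING SQUARE OF LIMITS FOR EVERY `n`-POINT SCHWINGER FUNCTION — finite `K`: the thermodynamic
# limit `→ Haf((V_{L^K}(z_v − z_u)))`; then `K → ∞`: `Haf((V_{L^K})) → Haf((S₂^{ℝ}))` with the (4.38)-shape RATE `(2k−1)!!·k·m^{−2(k−1)}·(2C_diff + a_∞⁻¹)·L^{−K}`;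
# both orders of the two limits give the same infinite-volume continuum Schwinger functions
# (Track A, DAG node N15 = NE2; FAN-OUT v1.1 §N15 s3 «KING-MODEL RUNG»; uses parts Ͱ-c (hafnian forms, continuity, Lipschitz), Ϝ-n∕Ϝ-o (`V_N`, the two-point square),
# Ϸ-d (the `K = ∞` side); count-neutral)

HONEST FRAMING.  Count-neutral (cell `pub-ymgap`, seat `pub-ymgap-dag-n15-e` g34; `--supports stmt-QuantumFields-27366 --as helper` = K3⁸
`SpineGivenEndpointR13SepCoPHV`).  King's `A = 0`, `g = 0` model ([King1986] C. King, Commun. Math. Phys. **102** (1986) 649–677): parts Ϝ-n∕Ϝ-o built the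
commuting square of the block TWO-point function — volume `→ ∞` at fixed `K` gives `V_{L^K}(z)` (`kingS2InfK`), then `K → ∞` gives `S₂^{ℝ}(z)` with rate
`(2C_diff + a_∞⁻¹)L^{−K}`, and the other order (part Ϝ-j after part Ϝ-d) gives the same `S₂^{ℝ}`.  By part Ͱ-b every `n`-point function is the hafnian of the
two-point kernel on the points, and the hafnian is continuous and Lipschitz in its entries (part Ͱ-c); so the whole square lifts to EVERY `n`-point Schwinger
function: (i) at finite `K`, the thermodynamic limit of `∫∏φ(z_i mod Ω_k)ρ_{P_K,Ω_k}` is `Haf((V_{L^K}(z_v − z_u))_{u,v∈S})`; (ii) these converge, as `K → ∞`, to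
`Haf((S₂^{ℝ}(z_v − z_u)))` — the limit of part Ϸ-d's other order — with the explicit rate `(2k−1)!!·k·(m⁻²)^{k−1}·(2C_diff + a_∞⁻¹)·L^{−K}` on `2k` points (uniform
bounds `|V_{L^K}|, |S₂^{ℝ}| ≤ m⁻²`).  NOT a node discharge (N15 is booked through n15-a's knit, untouched here); nothing Bałaban ∕ continuum-Yang–Mills ∕ `ℝ⁴` ∕ OS ∕
Clay.  0 `sorry`, 0 def; standard axioms.

WHAT THIS FILE PROVES (kernel).  §1 `kingS2_intCast_eq_sub`, ★ `tendsto_kingS2_intCast_volume`, ★★★ **`tendsto_integral_prod_eval_fineBlockLaw_volume`** (finite-`K` thermodynamic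
limit of every `n`-point function `→ Haf((V_{L^K}(z_v − z_u)))`); §2 `abs_kingS2InfK_le_inv_mass` (`|V_N| ≤ m⁻²`, as a limit of `|S₂^{(K)}| ≤ m⁻²`), ★★ `tendsto_hafnian_kingS2InfK`
(`K → ∞`), ★★★ **`abs_hafnian_kingS2InfK_sub_hafnian_kingS2Inf_le`** (THE RATE); §3 ★★ `nPoint_limits_commute` (both iterated limits equal `Haf((S₂^{ℝ}(z_v − z_u)))`).

HONEST SCOPE.  King's free model; constants of the tree, not optimised.  N15 untouched; counts unmoved.  Locators (use): [King1986] Thm 2.1 (2.22)–(2.23) p.654,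
Lemma 4.5 (4.38) p.675, (4.5) p.670.
-/

noncomputable section

open scoped BigOperators Topology
open Filter MeasureTheory

namespace Summit.QuantumFields.YangMills.BalabanUVNodes.N15KingModelRung

open Literature.MathematicalPhysics.QuantumFieldTheory.Balaban1983to89.B5Prop11Plancherel (Tor)
open Literature.MathematicalPhysics.QuantumFieldTheory.King1986 (aK aK_pos)
open Literature.MathematicalPhysics.QuantumFieldTheory.King1986.Torus
open Literature.Combinatorics.Enumerative (hafnian)
open Literature.Combinatorics.Enumerative.HafnianGeneratingFunction (subMat)
open FreeField

variable {d : ℕ}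

/-! ## §1 Finite `K`: the thermodynamic limit of every `n`-point function -/

section FiniteK

variable (N : ℕ) [NeZero N] (M : Fin (d + 1) → ℕ) [hM : ∀ ν, NeZero (M ν)]

/-- Translation invariance on lattice points at finite `K`: `S₂^{(K)}_Ω(z_u mod Ω, z_v mod Ω) = S₂^{(K)}_Ω(0, (z_v − z_u) mod Ω)`. [cite: King1986, (2.14) p.653] -/
theorem kingS2_intCast_eq_sub {m2 : ℝ} (hm : 0 < m2) (zu zv : Fin (d + 1) → ℤ) :
    kingS2 N M m2 (fun ν => ((zu ν : ℤ) : ZMod (M ν))) (fun ν => ((zv ν : ℤ) : ZMod (M ν)))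
      = kingS2 N M m2 0 (fun ν => (((zv - zu) ν : ℤ) : ZMod (M ν))) := by
  have h := kingS2_transl N M hm (fun ν => ((zu ν : ℤ) : ZMod (M ν))) (fun ν => ((zv ν : ℤ) : ZMod (M ν)))
    (-(fun ν => ((zu ν : ℤ) : ZMod (M ν))))
  rw [add_neg_cancel, ← sub_eq_add_neg, intCast_sub_eq M zu zv] at h
  exact h.symm

end FiniteK

/-- ★ At finite `K`, the two-point function at two lattice points converges to `V_N(z_v − z_u)` along any tori with all periods `→ ∞`.
[cite: King1986, Thm 2.1 (2.22) p.654, (4.5) p.670] -/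
theorem tendsto_kingS2_intCast_volume {N : ℕ} [NeZero N] (hN1 : 1 ≤ N) {m2 : ℝ} (hm : 0 < m2) (Mseq : ℕ → Fin (d + 1) → ℕ)
    (hpos : ∀ k ν, 0 < Mseq k ν) (hlim : ∀ ν, Tendsto (fun k => (Mseq k ν : ℝ)) atTop atTop) (zu zv : Fin (d + 1) → ℤ) :
    Tendsto (fun k => haveI : ∀ ν, NeZero (Mseq k ν) := fun ν => ⟨(hpos k ν).ne'⟩
      kingS2 N (Mseq k) m2 (fun ν => ((zu ν : ℤ) : ZMod (Mseq k ν))) (fun ν => ((zv ν : ℤ) : ZMod (Mseq k ν)))) atTop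
      (𝓝 (kingS2InfK N m2 (zv - zu))) := by
  have h := tendsto_kingS2_volume hN1 hm Mseq hpos hlim (zv - zu)
  refine h.congr fun k => ?_
  haveI : ∀ ν, NeZero (Mseq k ν) := fun ν => ⟨(hpos k ν).ne'⟩
  exact (kingS2_intCast_eq_sub N (Mseq k) hm zu zv).symm

section NPointFiniteK

variable {W : Type*} [DecidableEq W] [LinearOrder W]

/-- ★★★ **FINITE `K`: THE THERMODYNAMIC LIMIT OF EVERY `n`-POINT FUNCTION** of the law of the block averages of the fine free field (`N = L^K` fixed):
`∫∏_{i∈S}φ(z_i mod Ω_k)ρ_{P_K,Ω_k}(φ)dφ → Haf((V_N(z_v − z_u))_{u,v∈S})`. [cite: King1986, Thm 2.1 (2.22) p.654, (4.5) p.670] -/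
theorem tendsto_integral_prod_eval_fineBlockLaw_volume {N : ℕ} [NeZero N] (hN1 : 1 ≤ N) {m2 : ℝ} (hm : 0 < m2) (Mseq : ℕ → Fin (d + 1) → ℕ)
    (hpos : ∀ k ν, 0 < Mseq k ν) (hlim : ∀ ν, Tendsto (fun k => (Mseq k ν : ℝ)) atTop atTop) (z : W → Fin (d + 1) → ℤ) (S : Finset W) :
    Tendsto (fun k => haveI : ∀ ν, NeZero (Mseq k ν) := fun ν => ⟨(hpos k ν).ne'⟩
      ∫ φ : Tor (Mseq k) → ℝ, (∏ i ∈ S, φ (fun ν => ((z i ν : ℤ) : ZMod (Mseq k ν)))) * gaussDensity (fineBlockPrec (Mseq k) N m2) φ) atTop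
      (𝓝 (hafnian (subMat (Matrix.of fun u v : W => kingS2InfK N m2 (z v - z u)) S))) := by
  have e : (fun k => haveI : ∀ ν, NeZero (Mseq k ν) := fun ν => ⟨(hpos k ν).ne'⟩
      ∫ φ : Tor (Mseq k) → ℝ, (∏ i ∈ S, φ (fun ν => ((z i ν : ℤ) : ZMod (Mseq k ν)))) * gaussDensity (fineBlockPrec (Mseq k) N m2) φ)
      = fun k => haveI : ∀ ν, NeZero (Mseq k ν) := fun ν => ⟨(hpos k ν).ne'⟩
          hafnian (subMat (Matrix.of fun u v : W =>
            kingS2 N (Mseq k) m2 (fun ν => ((z u ν : ℤ) : ZMod (Mseq k ν))) (fun ν => ((z v ν : ℤ) : ZMod (Mseq k ν)))) S) := by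
    funext k
    haveI : ∀ ν, NeZero (Mseq k ν) := fun ν => ⟨(hpos k ν).ne'⟩
    exact integral_prod_eval_fineBlockLaw_eq_hafnian (Mseq k) N hm _ S
  rw [e]
  exact tendsto_hafnian_of_entries fun u v => tendsto_kingS2_intCast_volume hN1 hm Mseq hpos hlim (z u) (z v)

end NPointFiniteK

/-! ## §2 `K → ∞` of the finite-`K` infinite-volume `n`-point functions, with the rate -/

/-- `|V_N(z)| ≤ m⁻²` (`N ≥ 1`): the limit of part Ϝ-d's `|S₂^{(K)}| ≤ m⁻²` along cubic tori. [cite: King1986, (4.8) p.671] -/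
theorem abs_kingS2InfK_le_inv_mass {N : ℕ} [NeZero N] (hN1 : 1 ≤ N) {m2 : ℝ} (hm : 0 < m2) (z : Fin (d + 1) → ℤ) :
    |kingS2InfK N m2 z| ≤ m2⁻¹ := by
  have hlim := (tendsto_kingS2_volume hN1 hm (fun k _ => k + 1) (fun k _ => Nat.succ_pos k)
    (fun ν => by
      have : Tendsto (fun k : ℕ => ((k : ℝ) + 1)) atTop atTop := tendsto_atTop_add_const_right _ 1 tendsto_natCast_atTop_atTop
      refine this.congr fun k => ?_
      push_cast; ring) z).abs
  refine le_of_tendsto hlim (Eventually.of_forall fun k => ?_)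
  haveI : ∀ ν : Fin (d + 1), NeZero (k + 1) := fun _ => ⟨Nat.succ_ne_zero k⟩
  exact abs_kingS2_le N (fun _ => k + 1) hm _ _

section KToInfinity

variable (L : ℕ) {W : Type*} [DecidableEq W] [LinearOrder W]

/-- ★★ **`K → ∞` OF THE FINITE-`K` INFINITE-VOLUME `n`-POINT FUNCTIONS**: `Haf((V_{L^K}(z_v − z_u))) → Haf((S₂^{ℝ}(z_v − z_u)))` (odd `L ≥ 2`, `m² > 0`).
[cite: King1986, Thm 2.1 (2.22) p.654, Lemma 4.5 (4.38) p.675] -/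
theorem tendsto_hafnian_kingS2InfK (hLodd : Odd L) (hL : 2 ≤ L) {m2 : ℝ} (hm : 0 < m2) (z : W → Fin (d + 1) → ℤ) (S : Finset W) :
    Tendsto (fun K : ℕ => hafnian (subMat (Matrix.of fun u v : W => kingS2InfK (L ^ K) m2 (z v - z u)) S)) atTop
      (𝓝 (hafnian (subMat (Matrix.of fun u v : W => kingS2Inf m2 (z v - z u)) S))) :=
  tendsto_hafnian_of_entries fun u v => tendsto_kingS2InfK L hLodd hL hm (z v - z u)

/-- ★★★ **THE RATE**: on `2k` points, for every `K ≥ 1` (odd `L ≥ 2`, `m² > 0`, auxiliary `a > 0`),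
`|Haf((V_{L^K}(z_v − z_u))) − Haf((S₂^{ℝ}(z_v − z_u)))| ≤ (2k−1)!!·k·(m⁻²)^{k−1}·(2C_diff + a_∞⁻¹)·L^{−K}` — Lemma 4.5 (4.38)'s `L^{−K}` for EVERY infinite-volume
`n`-point Schwinger function of the free block field. [cite: King1986, Lemma 4.5 (4.38) p.675, Thm 2.1 (2.22) p.654] -/
theorem abs_hafnian_kingS2InfK_sub_hafnian_kingS2Inf_le (hLodd : Odd L) (hL : 2 ≤ L) {a m2 : ℝ} (ha : 0 < a) (hm : 0 < m2) {K : ℕ} (hK : 1 ≤ K)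
    (z : W → Fin (d + 1) → ℤ) {S : Finset W} {k : ℕ} (hS : S.card = 2 * k) :
    |hafnian (subMat (Matrix.of fun u v : W => kingS2InfK (L ^ K) m2 (z v - z u)) S)
        - hafnian (subMat (Matrix.of fun u v : W => kingS2Inf m2 (z v - z u)) S)|
      ≤ (Nat.doubleFactorial (2 * k - 1) : ℝ) * (k * (m2⁻¹) ^ (k - 1) * ((2 * CdiffM (d + 1) a m2 L + (aInf a L)⁻¹) * ((L : ℝ) ^ K)⁻¹)) := by
  haveI : NeZero L := ⟨by omega⟩
  have hLK : 1 ≤ L ^ K := Nat.one_le_pow K L (by omega)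
  refine abs_hafnian_sub_hafnian_le_of_card (by rw [Fintype.card_coe, hS]) (inv_nonneg.mpr hm.le) (fun u v => ?_) (fun u v => ?_) (fun u v => ?_)
  · exact abs_kingS2InfK_le_inv_mass hLK hm _
  · exact abs_kingS2Inf_le hm _
  · exact abs_kingS2InfK_sub_kingS2Inf_le L hLodd hL ha hm hK _

/-! ## §3 The square of limits commutes for every `n`-point function -/

/-- ★★ **BOTH ORDERS OF THE TWO LIMITS AGREE**: (volume `→ ∞` at fixed `K`, then `K → ∞`) and (`K → ∞` on each torus, then volume `→ ∞`) both give
`Haf((S₂^{ℝ}(z_v − z_u))_{u,v∈S})` for every finite family of lattice points — the first order by §1–§2, the second by part Ϸ-d.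
[cite: King1986, Thm 2.1 (2.22)–(2.23) p.654] -/
theorem nPoint_limits_commute (hLodd : Odd L) (hL : 2 ≤ L) {m2 : ℝ} (hm : 0 < m2) (Mseq : ℕ → Fin (d + 1) → ℕ) (hpos : ∀ k ν, 0 < Mseq k ν)
    (hlim : ∀ ν, Tendsto (fun k => (Mseq k ν : ℝ)) atTop atTop) (z : W → Fin (d + 1) → ℤ) (S : Finset W) :
    (∀ K : ℕ, Tendsto (fun k => haveI : ∀ ν, NeZero (Mseq k ν) := fun ν => ⟨(hpos k ν).ne'⟩
        haveI : NeZero L := ⟨by omega⟩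
        ∫ φ : Tor (Mseq k) → ℝ, (∏ i ∈ S, φ (fun ν => ((z i ν : ℤ) : ZMod (Mseq k ν)))) * gaussDensity (fineBlockPrec (Mseq k) (L ^ K) m2) φ) atTop
        (𝓝 (hafnian (subMat (Matrix.of fun u v : W => kingS2InfK (L ^ K) m2 (z v - z u)) S))))
    ∧ Tendsto (fun K : ℕ => hafnian (subMat (Matrix.of fun u v : W => kingS2InfK (L ^ K) m2 (z v - z u)) S)) atTop
        (𝓝 (hafnian (subMat (Matrix.of fun u v : W => kingS2Inf m2 (z v - z u)) S)))
    ∧ Tendsto (fun k => haveI : ∀ ν, NeZero (Mseq k ν) := fun ν => ⟨(hpos k ν).ne'⟩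
        ∫ φ : Tor (Mseq k) → ℝ, (∏ i ∈ S, φ (fun ν => ((z i ν : ℤ) : ZMod (Mseq k ν)))) * gaussDensity (fineBlockPrecLim (Mseq k) m2) φ) atTop
        (𝓝 (hafnian (subMat (Matrix.of fun u v : W => kingS2Inf m2 (z v - z u)) S))) := by
  haveI : NeZero L := ⟨by omega⟩
  refine ⟨fun K => ?_, tendsto_hafnian_kingS2InfK L hLodd hL hm z S, tendsto_integral_prod_eval_fineBlockLawLim_volume hm Mseq hpos hlim z S⟩
  exact tendsto_integral_prod_eval_fineBlockLaw_volume (Nat.one_le_pow K L (by omega)) hm Mseq hpos hlim z S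

end KToInfinity

end Summit.QuantumFields.YangMills.BalabanUVNodes.N15KingModelRung
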